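import Summits.ABC.ABC.Theses.DefiniteXi
import Literature.NumberTheory.EllipticCurves.PastenSpectralDegree
import HarnessLib

/-!
# Stub-ideation k2, generation 3 (FAMILY 2 — RESHAPE) for `stub_primeToSixDegreeBound`
# (crux `DefiniteXi.SteinbergCore`, stmt-ABC-15024, line `p6_tamagawa_split`)

Typed helper statements for `STUB-IDEAS-stub_primeToSixDegreeBound-2.md` (gen 3).  Generation 2's
PROVED helpers (T1 regime split, T2 quantifier change; `…StubIdeas2G2`, 0 sorry) stand and are kept
by reference.  Here: (T3) the VARIATIONAL / SPECTRAL-PRODUCT normal form (Pasten 2024 Thm 5.5: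
`δ_{1,N} ∣ ∏_{[χ]≠[χ₀]} η_{[χ₀]}([χ])`) — assembly `stub_of_spectralEtaSparsity` PROVED, and the
typed NEGATIVE `EtaProductSuperpoly` (the product is super-polynomial in `N` on the Fermat-quintic
Frey family, by Ribet lowering + iterated `ribet1990_levelRaising_pNew`; paper proof in the MD), so
`SpectralEtaSparsity A` is expected FALSE for every `A`; (T4) WEAKEN-AND-BOOTSTRAP — the
`|Δ_min|^δ`-slack form `WeakDegSlack`, which gives the route target `FreyDegreeBound` (hence the
stub) by the tree's `|Δ_min| ≤ K₀ deg⁶` (`XiBoundSzpiroBootstrap.abs_Δ_le_mul_deg_pow_six`).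
`Stub` is the registered stub verbatim (= `StubIdeas2G2.Stub`).
-/

noncomputable section

set_option linter.dupNamespace false

open scoped MatrixGroups

namespace Summit.ABC.ABC.Cruxes.SteinbergCore.StubIdeas2G3

open Literature.NumberTheory.EllipticCurves Literature.NumberTheory.EllipticCurves.ModularForms
open CongruenceSubgroup WeierstrassCurve
open Summit.ABC.ABC.Theses.DefiniteXi

/-- The registered stub, verbatim. [folklore] -/
def Stub : Prop :=
  ∀ ε : ℝ, 0 < ε → ∃ C : ℝ, ∀ a b : ℤ, IsCoprime a b → a * b * (a + b) ≠ 0 → ∀ (N : ℕ) [NeZero N], (Literature.NumberTheory.EllipticCurves.freyCurve a b).conductorNorm ℤ = N → ∀ D : Literature.NumberTheory.EllipticCurves.ModularForms.ModularParametrizationData (Literature.NumberTheory.EllipticCurves.freyCurve a b) N, (∀ D' : Literature.NumberTheory.EllipticCurves.ModularForms.ModularParametrizationData (Literature.NumberTheory.EllipticCurves.freyCurve a b) N, D.deg ≤ D'.deg) → ((D.deg / (ordProj[2] D.deg * ordProj[3] D.deg) : ℕ) : ℝ) ≤ C * (N : ℝ) ^ (2 + ε)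

/-- The route target gives the stub (= `Cruxes/…/AtomModuloBets.lean`, `Strategist.primeToSix_of_freyDegreeBound`;
re-proved here because crux workfiles are not built on the farm): a minimal datum has degree ≤ that of the
datum `X` provides, then `cps n ≤ n` (as in the landed `primeToSixDegreeBound_of_minimalDegreeBound`). [folklore] -/
theorem stub_of_freyDegreeBound (hX : FreyDegreeBound) : Stub := by
  intro ε hε
  obtain ⟨C, hC⟩ := hX ε hε
  refine ⟨C, fun a b hab h0 N _ hN D hDmin ↦ ?_⟩
  obtain ⟨D₀, hD₀⟩ := hC a b hab h0 N hN
  have h1 : (D.deg : ℝ) ≤ (D₀.deg : ℝ) := by exact_mod_cast hDmin D₀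
  have h2 : ((D.deg / (ordProj[2] D.deg * ordProj[3] D.deg) : ℕ) : ℝ) ≤ (D.deg : ℝ) := by
    exact_mod_cast Nat.div_le_self _ _
  exact h2.trans (h1.trans hD₀)

/-! ## Shared XS helper: a minimal datum exists as soon as some datum exists -/

/-- From any datum, a datum of minimal degree (well-ordering of `ℕ`). [folklore] -/
theorem exists_minimal_datum {W : WeierstrassCurve ℚ} {N : ℕ} [NeZero N]
    (h : Nonempty (ModularParametrizationData W N)) :
    ∃ D : ModularParametrizationData W N, ∀ D' : ModularParametrizationData W N, D.deg ≤ D'.deg := by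
  classical
  obtain ⟨D₀⟩ := h
  have H : ∃ n : ℕ, ∃ D : ModularParametrizationData W N, D.deg = n := ⟨D₀.deg, D₀, rfl⟩
  obtain ⟨D, hD⟩ := Nat.find_spec H
  exact ⟨D, fun D' ↦ hD ▸ Nat.find_min' H ⟨D', rfl⟩⟩

/-! ## T3 — spectral-product (variational) normal form -/

/-- Pasten's product `∏_{[χ] ≠ [χ₀]} η_{[χ₀]}([χ])` over the minimal primes of the anemic Hecke ring
`𝕋_{1,N}` other than the eigen-ideal of `f` (the right-hand side of Thm 5.5). [cite: PastenShimura2024, Thm. 5.5] -/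
def etaProduct (N : ℕ) [NeZero N] (f : CuspForm (Gamma0 N) 2) : ℕ :=
  ∏ P ∈ (finite_minimalPrimes_anemicHeckeRing N 2).toFinset.erase (eigenIdeal f),
    heckeCongruenceModulus f P

/-- **SpectralEtaSparsity (A)** — the reshaped intermediate: on Frey curves the full η-product of the
newform is `≤ C · N^A` (and positive).  T3's positive plan needs it at `A = 2 + ε`; the MD shows it is
FALSE for every `A` (see `EtaProductSuperpoly`). [folklore] -/
def SpectralEtaSparsity (A : ℝ) : Prop :=
  ∃ C : ℝ, ∀ a b : ℤ, IsCoprime a b → a * b * (a + b) ≠ 0 → ∀ (N : ℕ) [NeZero N],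
    (freyCurve a b).conductorNorm ℤ = N → ∀ D : ModularParametrizationData (freyCurve a b) N,
      0 < etaProduct N D.f ∧ (etaProduct N D.f : ℝ) ≤ C * (N : ℝ) ^ A

/-- **FreyOptimalTransport** (prime type; in print: Stevens/Stein–Watkins optimal quotient + Mazur–Kenku
`≤ 163`, Pasten 2024 §3 p. 13 = tree fact `PastenShimura2024_minimalDegree_le_163_mul` up to the
Frey model's 2-adic rescaling): a minimal Frey datum is within a uniform factor `K` of a datum that is
optimal in the isogeny class and has the same newform. [cite: PastenShimura2024, §3 p. 13] -/
def FreyOptimalTransport : Prop :=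
  ∃ K : ℕ, ∀ a b : ℤ, IsCoprime a b → a * b * (a + b) ≠ 0 → ∀ (N : ℕ) [NeZero N],
    (freyCurve a b).conductorNorm ℤ = N → ∀ D : ModularParametrizationData (freyCurve a b) N,
      (∀ D' : ModularParametrizationData (freyCurve a b) N, D.deg ≤ D'.deg) →
      ∃ (W' : WeierstrassCurve ℚ) (_ : W'.IsElliptic) (D' : ModularParametrizationData W' N),
        D'.f = D.f ∧
        (∀ (W'' : WeierstrassCurve ℚ) [W''.IsElliptic] (D'' : ModularParametrizationData W'' N),
            D''.f = D'.f → D'.modularDegree ≤ D''.modularDegree) ∧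
        D.deg ≤ K * D'.deg

/-- **S helper** (one cycle): each factor `η_f(P)`, `P ≠ 𝕀_f` minimal, is nonzero for an integral
newform `f` (`𝕋/𝕀_f ≅ ℤ` has Krull dimension 1, so `𝕀_f` is minimal and `P ⊄ 𝕀_f`; the image of `P`
in `ℤ` is a nonzero ideal; `congruenceModulus_ne_zero_iff`). Stated for Frey newforms. [folklore] -/
def EtaProductPos : Prop :=
  ∀ a b : ℤ, IsCoprime a b → a * b * (a + b) ≠ 0 → ∀ (N : ℕ) [NeZero N],
    (freyCurve a b).conductorNorm ℤ = N → ∀ D : ModularParametrizationData (freyCurve a b) N,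
      0 < etaProduct N D.f

/-- **T3 assembly (PROVED): Thm 5.5 + transport + SpectralEtaSparsity(2+ε) ⟹ Stub** — indeed the FULL
degree bound: `cps(deg D) ≤ deg D ≤ K·δ_{1,N} ≤ K·∏η ≤ K·C·N^{2+ε}`. [folklore] -/
theorem stub_of_spectralEtaSparsity (h55 : PastenShimura2024_thm_5_5) (hT : FreyOptimalTransport)
    (hSS : ∀ ε : ℝ, 0 < ε → SpectralEtaSparsity (2 + ε)) : Stub := by
  intro ε hε
  obtain ⟨C, hC⟩ := hSS ε hε
  obtain ⟨K, hK⟩ := hT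
  refine ⟨K * C, fun a b hab h0 N _ hN D hmin ↦ ?_⟩
  obtain ⟨W', hW', D', hf, hopt, hdeg⟩ := hK a b hab h0 N hN D hmin
  obtain ⟨hpos, hle⟩ := hC a b hab h0 N hN D
  have hdvd : D'.modularDegree ∣ etaProduct N D'.f := h55 N W' D' hopt
  rw [hf] at hdvd
  have h1 : D'.deg ≤ etaProduct N D.f := Nat.le_of_dvd hpos hdvd
  have h2 : ((D.deg / (ordProj[2] D.deg * ordProj[3] D.deg) : ℕ) : ℝ) ≤ (D.deg : ℝ) := by
    exact_mod_cast Nat.div_le_self _ _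
  have h3 : (D.deg : ℝ) ≤ (K : ℝ) * (etaProduct N D.f : ℝ) := by
    have e1 : (D.deg : ℝ) ≤ (K : ℝ) * (D'.deg : ℝ) := by exact_mod_cast hdeg
    have e2 : (D'.deg : ℝ) ≤ (etaProduct N D.f : ℝ) := by exact_mod_cast h1
    exact e1.trans (mul_le_mul_of_nonneg_left e2 (Nat.cast_nonneg K))
  calc ((D.deg / (ordProj[2] D.deg * ordProj[3] D.deg) : ℕ) : ℝ) ≤ (D.deg : ℝ) := h2
    _ ≤ (K : ℝ) * (etaProduct N D.f : ℝ) := h3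
    _ ≤ (K : ℝ) * (C * (N : ℝ) ^ (2 + ε)) := by gcongr
    _ = K * C * (N : ℝ) ^ (2 + ε) := by ring

/-- **NEGATIVE TARGET (refuter, XL): the η-product is super-polynomial on Frey curves** — for every
exponent `A` and constant `C` some Frey datum has `∏η > C·N^A`.  Paper proof (MD §T3): on
`(a,b) = (x⁵, 1)`, `x ≡ 15 (mod 32)`, `x ≡ 1 (mod 5)`, `x` a product of `s` odd primes, every `q ∣ x`
has `5 ∣ v_q(Δ_min) = 10`, so `ρ̄_{E,5}` (irreducible, Mazur–Kenku) is unramified at `q`; Ribet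
lowering then ITERATED `ribet1990_levelRaising_pNew` (`tr ρ̄(Frob_q) = ±(q+1)` at such `q`) give a
newform `g_S` of level `M_S ∣ N` with `{q ∣ x : q ∣ M_S} = S` for EVERY `S ⊆ {q ∣ x}`: `2^s − 1`
classes `[χ_S] ≠ [χ₀]`, each with `5 ∣ η_{[χ₀]}([χ_S])` (`dvd_heckeCongruenceModulus_of_forall_dvd`),
whence `∏η ≥ 5^{2^s−1}` while `log N ≤ 6 log x + O(1) ≍ s log s`. [folklore] -/
def EtaProductSuperpoly : Prop :=
  ∀ A C : ℝ, ∃ a b : ℤ, IsCoprime a b ∧ a * b * (a + b) ≠ 0 ∧ ∃ (N : ℕ) (_ : NeZero N),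
    (freyCurve a b).conductorNorm ℤ = N ∧ ∃ D : ModularParametrizationData (freyCurve a b) N,
      C * (N : ℝ) ^ A < (etaProduct N D.f : ℝ)

/-- Calibration (PROVED): the negative target kills the reshaped intermediate at every exponent. [folklore] -/
theorem not_spectralEtaSparsity_of_superpoly (h : EtaProductSuperpoly) (A : ℝ) :
    ¬ SpectralEtaSparsity A := by
  rintro ⟨C, hC⟩
  obtain ⟨a, b, hab, h0, N, _, hN, D, hlt⟩ := h A C
  exact (not_lt.mpr (hC a b hab h0 N hN D).2) hlt

/-- The combinatorial heart of the negative, typed (refuter sub-target, L): many minimal primes of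
`𝕋_{1,N}` congruent to the Frey eigencharacter mod `5` — for every `s` some Frey datum has at least
`2^s − 1` minimal primes `P ≠ 𝕀_f` with `5 ∣ η_f(P)`. [folklore] -/
def ManyCongruentClasses : Prop :=
  ∀ s : ℕ, ∃ a b : ℤ, IsCoprime a b ∧ a * b * (a + b) ≠ 0 ∧ ∃ (N : ℕ) (_ : NeZero N),
    (freyCurve a b).conductorNorm ℤ = N ∧ (N : ℝ) ≤ Real.exp (7 * s * Real.log (s + 2) + 7) ∧
    ∃ D : ModularParametrizationData (freyCurve a b) N,
      2 ^ s - 1 ≤ (((finite_minimalPrimes_anemicHeckeRing N 2).toFinset.erase (eigenIdeal D.f)).filter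
        (fun P ↦ 5 ∣ heckeCongruenceModulus D.f P)).card

/-! ## T4 — weaken-and-bootstrap: the `|Δ_min|^δ`-slack form -/

/-- **WeakDegSlack**: the minimal Frey degree is `≤ C · N^{2+ε} · |Δ_min|^δ` for EVERY `ε, δ > 0`
(`C` depending on both).  Weaker-looking than the route target `X = FreyDegreeBound` (extra factor
`|Δ_min|^δ`), equivalent to it by the bootstrap below. [folklore] -/
def WeakDegSlack : Prop :=
  ∀ ε : ℝ, 0 < ε → ∀ δ : ℝ, 0 < δ → ∃ C : ℝ, ∀ a b : ℤ, IsCoprime a b → a * b * (a + b) ≠ 0 →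
    ∀ (N : ℕ) [NeZero N], (freyCurve a b).conductorNorm ℤ = N →
      ∀ D : ModularParametrizationData (freyCurve a b) N,
        (∀ D' : ModularParametrizationData (freyCurve a b) N, D.deg ≤ D'.deg) →
          (D.deg : ℝ) ≤ C * (N : ℝ) ^ (2 + ε) * (((freyCurve a b).minimalDiscriminantNorm ℤ : ℕ) : ℝ) ^ δ

/-- **M helper (one prover cycle) — TARGET: the bootstrap `WeakDegSlack → FreyDegreeBound`.** Given `ε`,
apply the slack form at `(ε/2, δ)` with `δ = ε / (12 (2 + ε))`, so `1 − 6δ = (4+ε)/(4+2ε)`; with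
`|Δ_min| ≤ K₀ deg⁶` (tree: `XiBoundSzpiroBootstrap.abs_Δ_le_mul_deg_pow_six` +
`cast_minimalDiscriminantNorm_freyCurve_le_deg`, module `Summits.ABC.ABC.Theorems.DefiniteXiXiBoundSzpiroBootstrap`)
get `deg^{1−6δ} ≤ C K₀^δ N^{2+ε/2}`, i.e. `deg ≤ (C K₀^δ)^{(4+2ε)/(4+ε)} · N^{2+ε}` (exactly); a minimal
datum exists by `FreyModularity` + `exists_minimal_datum`.  Pure `Real.rpow` bookkeeping. [folklore] -/
def BootstrapTarget : Prop :=
  FreyModularity → WeakDegSlack → FreyDegreeBound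

/-- **T4 assembly (PROVED modulo the M helper): the slack form gives the stub** (through the route
target, `stub_of_freyDegreeBound`). [folklore] -/
theorem stub_of_weakDegSlack (hboot : BootstrapTarget) (hmod : FreyModularity) (h : WeakDegSlack) :
    Stub :=
  stub_of_freyDegreeBound (hboot hmod h)

/-- Converse calibration (PROVED): the route target gives the slack form (`|Δ_min| ≥ 1`, so the extra
factor is `≥ 1`) — T4 RELOCATES the exponent bookkeeping, it does not weaken the atom. [folklore] -/
theorem weakDegSlack_of_freyDegreeBound (hX : FreyDegreeBound) : WeakDegSlack := by
  intro ε hε δ hδ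
  obtain ⟨C, hC⟩ := hX ε hε
  refine ⟨max C 0, fun a b hab h0 N _ hN D hmin ↦ ?_⟩
  obtain ⟨D₀, hD₀⟩ := hC a b hab h0 N hN
  have hM : (1 : ℝ) ≤ (((freyCurve a b).minimalDiscriminantNorm ℤ : ℕ) : ℝ) := by
    exact_mod_cast minimalDiscriminantNorm_pos_holds (freyCurve a b)
  have hMδ : (1 : ℝ) ≤ (((freyCurve a b).minimalDiscriminantNorm ℤ : ℕ) : ℝ) ^ δ :=
    Real.one_le_rpow hM hδ.le
  have hNpos : (0 : ℝ) ≤ (N : ℝ) ^ (2 + ε) := by positivity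
  calc (D.deg : ℝ) ≤ (D₀.deg : ℝ) := by exact_mod_cast hmin D₀
    _ ≤ C * (N : ℝ) ^ (2 + ε) := hD₀
    _ ≤ max C 0 * (N : ℝ) ^ (2 + ε) := by gcongr; exact le_max_left _ _
    _ = max C 0 * (N : ℝ) ^ (2 + ε) * 1 := (mul_one _).symm
    _ ≤ max C 0 * (N : ℝ) ^ (2 + ε) * (((freyCurve a b).minimalDiscriminantNorm ℤ : ℕ) : ℝ) ^ δ :=
        mul_le_mul_of_nonneg_left hMδ (mul_nonneg (le_max_right _ _) hNpos)

end Summit.ABC.ABC.Cruxes.SteinbergCore.StubIdeas2G3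

end
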